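import Summits.QuantumFields.YangMills.Theorems.BalabanLadderNTStrongCouplingClosedSix
import Literature.MathematicalPhysics.QuantumFieldTheory.StrongCouplingClustering
import Literature.MathematicalPhysics.QuantumLattice.LatticeGaugeDLRSymmetry
import HarnessLib

/-!
# Crux `NT` (stmt-QuantumFields-19353), strong-coupling rung: closed plaquette families — slabs, splitting, the
# lower bound `6`, and bond covering across a slab (toolkit for the tube classification behind `MirrorFloorSU2`)

Helper file of the fleet lead prover of crux `NT` (unit `ym-spine-19353-p1`, g18).  A finite family `F` of plaquettes of
`ℤ⁴` is CLOSED when every bond of every member lies in another member (no private bond; the surviving families of the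
strong-coupling expansion).  This file is the definition-free toolkit of a HAND PROOF (no kernel search) of the
classification of the closed families of at most ten plaquettes through a time-mirror pair of plaquettes (file
`…StrongCouplingMirrorClass`), which discharges the one hypothesis `hclass` of
`…StrongCouplingMirrorJet.torusCov_mirror_floor_su2_single` (ym-idea-8 g5):

* `two_le_linkCover_of_closed` — closed ⇒ every bond of a member is covered twice (`linkCover ≥ 2`), the hypothesis of
  the tree's slab lemma `Literature…four_le_card_filter_level` («four plaquettes in every occupied slab»), whence
  `four_le_card_slab_of_closed` and `twelve_le_card_of_three_slabs`;
* `closed_map_plaquetteShift`, `six_le_card_of_closed` — closedness is translation invariant, hence (by the rooted kernel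
  certificate `not_closed_of_card_le_five` of `…ClosedSix`) EVERY non-empty closed family of `ℤ⁴` has at least six members;
* `closed_filter_le`, `closed_filter_ge`, `twelve_le_card_of_gap` — SPLITTING: if no member parallel to the axis `i` is
  based at level `t`, the members based at levels `≤ t` and those at levels `≥ t + 1` are two closed families; if both are
  non-empty the family has at least twelve members;
* `cases_of_transverse_mem` — the plaquettes of `ℤ⁴` containing a bond `(y, m)` transverse to the time axis `0`
  (`m ≠ 0`): non-temporal plaquettes based at time `y 0`, and the two temporal plaquettes `(y; 0, m)`, `(y - e₀; 0, m)`.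

HONEST FRAMING: lattice combinatorics only; nothing about measures, `β`, NT or the gap.
-/

namespace Summit.QuantumFields.YangMills.Cruxes.NT.StrongCouplingRung.ClosedFamilies

open Finset
open Literature.Probability.LatticeModels (Site)
open Literature.MathematicalPhysics.QuantumLattice (ZdEdge ZdPlaquette plaquetteEdges plaquetteShift edgeShift
  plaquetteShift_apply plaquetteEdges_plaquetteShift)
open Literature.MathematicalPhysics.QuantumFieldTheory (IsParallel linkCover mk_mem_plaquetteEdges_iff
  level_of_mem_plaquetteEdges level_bounds_of_mem_plaquetteEdges)

variable {d : ℕ}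

/-! ### Closed families: double covering, translation invariance, at least six members -/

/-- In a closed family every bond of a member bounds at least two members. [folklore] -/
theorem two_le_linkCover_of_closed {F : Finset (ZdPlaquette d)}
    (hN : ∀ p ∈ F, ∀ ℓ ∈ plaquetteEdges p, ∃ p' ∈ F, p' ≠ p ∧ ℓ ∈ plaquetteEdges p')
    {p : ZdPlaquette d} (hp : p ∈ F) {ℓ : ZdEdge d} (hℓ : ℓ ∈ plaquetteEdges p) : 2 ≤ linkCover F ℓ := by
  classical
  obtain ⟨p', hp', hne, hℓ'⟩ := hN p hp ℓ hℓ
  unfold linkCover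
  calc 2 = ({p, p'} : Finset (ZdPlaquette d)).card := (card_pair hne.symm).symm
    _ ≤ _ := by
      refine card_le_card fun q hq => ?_
      rw [mem_insert, mem_singleton] at hq
      rcases hq with rfl | rfl
      · exact mem_filter.2 ⟨hp, hℓ⟩
      · exact mem_filter.2 ⟨hp', hℓ'⟩

/-- Closedness is invariant under lattice translations. [folklore] -/
theorem closed_map_plaquetteShift {F : Finset (ZdPlaquette d)}
    (hN : ∀ p ∈ F, ∀ ℓ ∈ plaquetteEdges p, ∃ p' ∈ F, p' ≠ p ∧ ℓ ∈ plaquetteEdges p') (v : Site d) :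
    ∀ p ∈ F.map (plaquetteShift v).toEmbedding, ∀ ℓ ∈ plaquetteEdges p,
      ∃ p' ∈ F.map (plaquetteShift v).toEmbedding, p' ≠ p ∧ ℓ ∈ plaquetteEdges p' := by
  intro p hp ℓ hℓ
  rw [mem_map] at hp
  obtain ⟨p₀, hp₀, rfl⟩ := hp
  rw [Equiv.toEmbedding_apply, plaquetteEdges_plaquetteShift, mem_map] at hℓ
  obtain ⟨ℓ₀, hℓ₀, rfl⟩ := hℓ
  obtain ⟨p₀', hp₀', hne, hℓ₀'⟩ := hN p₀ hp₀ ℓ₀ hℓ₀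
  refine ⟨(plaquetteShift v).toEmbedding p₀', mem_map_of_mem _ hp₀',
    fun h => hne ((plaquetteShift v).injective h), ?_⟩
  rw [Equiv.toEmbedding_apply, plaquetteEdges_plaquetteShift]
  exact mem_map_of_mem _ hℓ₀'

/-- **Every non-empty closed family of plaquettes of `ℤ⁴` has at least six members** (translate a member to `e₀` and apply
the rooted certificate `not_closed_of_card_le_five`). [folklore] -/
theorem six_le_card_of_closed {F : Finset (ZdPlaquette 4)} (hne : F.Nonempty)
    (hN : ∀ p ∈ F, ∀ ℓ ∈ plaquetteEdges p, ∃ p' ∈ F, p' ≠ p ∧ ℓ ∈ plaquetteEdges p') : 6 ≤ F.card := by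
  obtain ⟨r, hr⟩ := hne
  by_contra hlt
  push Not at hlt
  have hN' := closed_map_plaquetteShift hN (![1, 0, 0, 0] - r.1)
  have hr' : (plaquetteShift (![1, 0, 0, 0] - r.1)).toEmbedding r ∈
      F.map (plaquetteShift (![1, 0, 0, 0] - r.1)).toEmbedding := mem_map_of_mem _ hr
  have h1 : ((plaquetteShift (![1, 0, 0, 0] - r.1)).toEmbedding r).1 = ![1, 0, 0, 0] := by
    rw [Equiv.toEmbedding_apply, plaquetteShift_apply]
    exact add_sub_cancel r.1 _
  exact not_closed_of_card_le_five _ hr' h1 (by rw [card_map]; omega) hN'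

/-! ### Splitting at an empty slab -/

/-- If no member parallel to the axis `i` is based at level `t`, the members based at levels `≤ t` form a closed family.
[folklore] -/
theorem closed_filter_le {F : Finset (ZdPlaquette d)}
    (hN : ∀ p ∈ F, ∀ ℓ ∈ plaquetteEdges p, ∃ p' ∈ F, p' ≠ p ∧ ℓ ∈ plaquetteEdges p') (i : Fin d) (t : ℤ)
    (hnone : ∀ p ∈ F, IsParallel p i → p.1 i ≠ t) :
    ∀ p ∈ F.filter (fun p => p.1 i ≤ t), ∀ ℓ ∈ plaquetteEdges p,
      ∃ p' ∈ F.filter (fun p => p.1 i ≤ t), p' ≠ p ∧ ℓ ∈ plaquetteEdges p' := by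
  intro p hp ℓ hℓ
  obtain ⟨hpF, hpt⟩ := mem_filter.1 hp
  obtain ⟨p', hp'F, hne, hℓ'⟩ := hN p hpF ℓ hℓ
  refine ⟨p', mem_filter.2 ⟨hp'F, ?_⟩, hne, hℓ'⟩
  have hℓt : ℓ.1 i ≤ t := by
    rcases level_of_mem_plaquetteEdges hℓ i with h | ⟨h, hpar, -⟩
    · omega
    · have := hnone p hpF hpar
      omega
  have := (level_bounds_of_mem_plaquetteEdges hℓ' i).1
  omega

/-- If no member parallel to the axis `i` is based at level `t`, the members based at levels `≥ t + 1` form a closed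
family. [folklore] -/
theorem closed_filter_ge {F : Finset (ZdPlaquette d)}
    (hN : ∀ p ∈ F, ∀ ℓ ∈ plaquetteEdges p, ∃ p' ∈ F, p' ≠ p ∧ ℓ ∈ plaquetteEdges p') (i : Fin d) (t : ℤ)
    (hnone : ∀ p ∈ F, IsParallel p i → p.1 i ≠ t) :
    ∀ p ∈ F.filter (fun p => t + 1 ≤ p.1 i), ∀ ℓ ∈ plaquetteEdges p,
      ∃ p' ∈ F.filter (fun p => t + 1 ≤ p.1 i), p' ≠ p ∧ ℓ ∈ plaquetteEdges p' := by
  intro p hp ℓ hℓ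
  obtain ⟨hpF, hpt⟩ := mem_filter.1 hp
  obtain ⟨p', hp'F, hne, hℓ'⟩ := hN p hpF ℓ hℓ
  refine ⟨p', mem_filter.2 ⟨hp'F, ?_⟩, hne, hℓ'⟩
  have h1 := (level_bounds_of_mem_plaquetteEdges hℓ i).1
  rcases level_of_mem_plaquetteEdges hℓ' i with h | ⟨h, hpar, -⟩
  · omega
  · have := hnone p' hp'F hpar
    omega

/-- **Splitting bound.** A closed family of plaquettes of `ℤ⁴` with no member parallel to `i` based at level `t`, but with
members based at levels `≤ t` and `≥ t + 1`, has at least twelve members. [folklore] -/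
theorem twelve_le_card_of_gap {F : Finset (ZdPlaquette 4)}
    (hN : ∀ p ∈ F, ∀ ℓ ∈ plaquetteEdges p, ∃ p' ∈ F, p' ≠ p ∧ ℓ ∈ plaquetteEdges p') (i : Fin 4) (t : ℤ)
    (hnone : ∀ p ∈ F, IsParallel p i → p.1 i ≠ t) (h₁ : ∃ p ∈ F, p.1 i ≤ t) (h₂ : ∃ p ∈ F, t + 1 ≤ p.1 i) :
    12 ≤ F.card := by
  obtain ⟨p₁, hp₁, hp₁t⟩ := h₁
  obtain ⟨p₂, hp₂, hp₂t⟩ := h₂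
  have h6a := six_le_card_of_closed ⟨p₁, mem_filter.2 ⟨hp₁, hp₁t⟩⟩ (closed_filter_le hN i t hnone)
  have h6b := six_le_card_of_closed ⟨p₂, mem_filter.2 ⟨hp₂, hp₂t⟩⟩ (closed_filter_ge hN i t hnone)
  have hdisj : Disjoint (F.filter fun p => p.1 i ≤ t) (F.filter fun p => t + 1 ≤ p.1 i) :=
    disjoint_filter.2 fun p _ h h' => by omega
  calc 12 ≤ (F.filter fun p => p.1 i ≤ t).card + (F.filter fun p => t + 1 ≤ p.1 i).card := by omega
    _ = ((F.filter fun p => p.1 i ≤ t) ∪ (F.filter fun p => t + 1 ≤ p.1 i)).card :=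
        (card_union_of_disjoint hdisj).symm
    _ ≤ F.card := card_le_card (union_subset (filter_subset _ _) (filter_subset _ _))

/-! ### Time slabs of `ℤ⁴` -/

/-- **Four members in every occupied slab** (the tree's slab lemma `four_le_card_filter_level` for closed families): if a
closed family has a member parallel to the axis `i` based at level `t`, it has at least four. [folklore] -/
theorem four_le_card_slab_of_closed {F : Finset (ZdPlaquette d)}
    (hN : ∀ p ∈ F, ∀ ℓ ∈ plaquetteEdges p, ∃ p' ∈ F, p' ≠ p ∧ ℓ ∈ plaquetteEdges p') (i : Fin d) (t : ℤ)
    (hex : ∃ p ∈ F, IsParallel p i ∧ p.1 i = t) :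
    4 ≤ (F.filter fun p => IsParallel p i ∧ p.1 i = t).card :=
  Literature.MathematicalPhysics.QuantumFieldTheory.four_le_card_filter_level F i t
    (fun _ hp _ he _ _ => two_le_linkCover_of_closed hN hp he) hex

/-- Three occupied consecutive-or-not slabs cost twelve members: if a closed family has members parallel to `i` at three
distinct levels, it has at least twelve members. [folklore] -/
theorem twelve_le_card_of_three_slabs {F : Finset (ZdPlaquette d)}
    (hN : ∀ p ∈ F, ∀ ℓ ∈ plaquetteEdges p, ∃ p' ∈ F, p' ≠ p ∧ ℓ ∈ plaquetteEdges p') (i : Fin d) {t₁ t₂ t₃ : ℤ}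
    (h₁₂ : t₁ ≠ t₂) (h₁₃ : t₁ ≠ t₃) (h₂₃ : t₂ ≠ t₃)
    (h₁ : ∃ p ∈ F, IsParallel p i ∧ p.1 i = t₁) (h₂ : ∃ p ∈ F, IsParallel p i ∧ p.1 i = t₂)
    (h₃ : ∃ p ∈ F, IsParallel p i ∧ p.1 i = t₃) : 12 ≤ F.card := by
  have h3 : ({t₁, t₂, t₃} : Finset ℤ).card = 3 := by
    rw [card_insert_of_notMem (by simp [h₁₂, h₁₃]), card_insert_of_notMem (by simp [h₂₃]), card_singleton]
  have := Literature.MathematicalPhysics.QuantumFieldTheory.four_mul_card_le_card F i {t₁, t₂, t₃} (by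
    intro t ht
    simp only [mem_insert, mem_singleton] at ht
    rcases ht with rfl | rfl | rfl
    · exact four_le_card_slab_of_closed hN i _ h₁
    · exact four_le_card_slab_of_closed hN i _ h₂
    · exact four_le_card_slab_of_closed hN i _ h₃)
  omega


/-- A plaquette of `ℤ⁴` is parallel to the time axis `0` iff its first direction is `0`. [folklore] -/
theorem isParallel_zero_iff (p : ZdPlaquette 4) : IsParallel p 0 ↔ p.2.1.1 = 0 := by
  refine ⟨fun h => h.elim id fun h2 => ?_, Or.inl⟩
  have := p.2.2
  rw [h2] at this
  exact absurd this (Fin.not_lt_zero _)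

/-- **The plaquettes through a transverse bond.** A bond `(y, m)` of `ℤ⁴` with `m ≠ 0` lies only in: plaquettes NOT
parallel to the time axis based at time `y 0`, the temporal plaquette `(y; 0, m)`, and the temporal plaquette
`(y - e₀; 0, m)`. [folklore] -/
theorem cases_of_transverse_mem {x y : Site 4} {j k : Fin 4} {hjk : j < k} {m : Fin 4} (hm : (0 : Fin 4) < m)
    (h : ((y, m) : ZdEdge 4) ∈ plaquetteEdges ((x, ⟨(j, k), hjk⟩) : ZdPlaquette 4)) :
    (x 0 = y 0 ∧ j ≠ 0) ∨ (j = 0 ∧ k = m ∧ x = y) ∨ (j = 0 ∧ k = m ∧ x = y - Pi.single 0 1) := by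
  rw [mk_mem_plaquetteEdges_iff] at h
  simp only at h
  rcases h with ⟨rfl, rfl | rfl⟩ | ⟨rfl, rfl | rfl⟩
  · exact Or.inl ⟨rfl, hm.ne'⟩
  · refine Or.inl ⟨?_, hm.ne'⟩
    have hk : (0 : Fin 4) ≠ k := (hm.trans hjk).ne
    simp [Pi.single_eq_of_ne hk]
  · by_cases hj : j = 0
    · subst hj
      exact Or.inr (Or.inr ⟨rfl, rfl, by simp⟩)
    · refine Or.inl ⟨?_, hj⟩
      simp [Pi.single_eq_of_ne (Ne.symm hj)]
  · by_cases hj : j = 0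
    · exact Or.inr (Or.inl ⟨hj, rfl, rfl⟩)
    · exact Or.inl ⟨rfl, hj⟩

end Summit.QuantumFields.YangMills.Cruxes.NT.StrongCouplingRung.ClosedFamilies
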